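import Summits.CriticalPhenomena.PercolationContinuityZ3.Theorems.PercNearOneGluingNoHeavyLowerTailOneLayerTwoFingerRegime
import Summits.CriticalPhenomena.PercolationContinuityZ3.Theorems.PercNearOneGluingNoHeavyLowerTailOneCutFiveAssembly
import HarnessLib

/-!
# `NoHeavyLowerTail` (stmt-CriticalPhenomena-4575), |A| = 5 rung — `X′(5)` and `oneCut(5)` at a ONE-LAYER observer-relay

Support file (prover prim-cplus-engine gen 11; `--supports stmt-CriticalPhenomena-4575`).  Wires THEOREM OL
(`oneLayer_twoFingerHub_glued_of_regime`, files `…OneLayerTwoFinger{Tools,Core,Hub,Regime}`) into the vocabulary of the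
|A| = 5 assembly (`…OneCutFiveAssembly`, `OneCutFive.TwoFingerHub` = `X′(5)`, `OneCutFive.OneCut5` = `oneCut(5)`):

* `OneCutFive.twoFingerHub_at_oneLayer_observer` — the instance of the (open) two-finger hub bound `TwoFingerHub` at
  `a = o` for every relay set `A` of five relays containing the observer `o`, when `o` is ONE-LAYER (every pair `{o,u}` with
  `u ∉ A` has weight `0`): `E N > 4 ⟹ μ{|T_o| ≤ 2} ≤ max_{b ∈ A ∖ o} μ(o ↮ b)`;
* `OneCutFive.oneCut5_at_oneLayer_observer` — hence the instance of `oneCut(5)` (`OneCut5`) for such `(A, o)`, all `n`.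

This is the `K₅`-corner regime in which the hypothesis-free ("abstract type-law") form of `X′(5)@o` fails; the proof is
the hair-resampling argument of THEOREM OL. [cite: KozmaNitzan2024, Lemma 2 (p. 6), Lemma 5 (p. 13)]
-/

noncomputable section

namespace Summit.CriticalPhenomena.PercolationContinuityZ3.Theorems

open MeasureTheory Set Literature.Probability.LatticeModels Literature.Probability.Percolation
open scoped Classical BigOperators

namespace OneCutFive

variable {n : ℕ}

/-- **`X′(5)` at a one-layer observer-relay** (instance of `TwoFingerHub` at `a = o`): five relays `A ∋ o`, every pair
`{o,u}` with `u ∉ A` of weight `0`, and `E N = Σ_{x ∈ A} μ(o ↔ x) > 4`; then `μ{|T_o| ≤ 2} ≤ t` for every `t` bounding the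
cuts at `o`, `μ(o ↮ b) ≤ t` (`b ∈ A ∖ o`).  From `oneLayer_twoFingerHub_glued_of_regime` (THEOREM OL).
[cite: KozmaNitzan2024, Lemma 2 (p. 6), Lemma 5 (p. 13)] -/
theorem twoFingerHub_at_oneLayer_observer (w : Sym2 (Fin n) → unitInterval) (A : Finset (Fin n)) (o : Fin n)
    (hA : A.card = 5) (ho : o ∈ A) (hiso : ∀ u, u ∉ A → w s(o, u) = 0)
    (hEN : 4 < ∑ x ∈ A, (prodBernoulli w).real (openConn o x)) (t : ℝ)
    (hcut : ∀ b ∈ A, b ≠ o → (prodBernoulli w).real (openConn o b)ᶜ ≤ t) :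
    (prodBernoulli w).real {ω : BondConfig (Fin n) | (A.filter fun x => ω ∈ openConn o x).card ≤ 2} ≤ t := by
  -- the four other relays
  have hE : (A.erase o).card = 3 + 1 := by rw [Finset.card_erase_of_mem ho, hA]
  obtain ⟨a, B, haB, hAB, hB⟩ := Finset.card_eq_succ.mp hE
  obtain ⟨b, c, d, hbc, hbd, hcd, rfl⟩ := Finset.card_eq_three.mp hB
  have hmemE : ∀ x, x ∈ A.erase o ↔ x = a ∨ x = b ∨ x = c ∨ x = d := by
    intro x; rw [← hAB]; simp only [Finset.mem_insert, Finset.mem_singleton]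
  have hmemA : ∀ x, x ∈ A → x = o ∨ x = a ∨ x = b ∨ x = c ∨ x = d := by
    intro x hx
    by_cases hxo : x = o
    · exact Or.inl hxo
    · exact Or.inr ((hmemE x).1 (Finset.mem_erase.2 ⟨hxo, hx⟩))
  have haE : a ∈ A.erase o := (hmemE a).2 (Or.inl rfl)
  have hbE : b ∈ A.erase o := (hmemE b).2 (Or.inr (Or.inl rfl))
  have hcE : c ∈ A.erase o := (hmemE c).2 (Or.inr (Or.inr (Or.inl rfl)))
  have hdE : d ∈ A.erase o := (hmemE d).2 (Or.inr (Or.inr (Or.inr rfl)))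
  have hao : a ≠ o := (Finset.mem_erase.1 haE).1
  have hbo : b ≠ o := (Finset.mem_erase.1 hbE).1
  have hco : c ≠ o := (Finset.mem_erase.1 hcE).1
  have hdo : d ≠ o := (Finset.mem_erase.1 hdE).1
  have haA : a ∈ A := (Finset.mem_erase.1 haE).2
  have hbA : b ∈ A := (Finset.mem_erase.1 hbE).2
  have hcA : c ∈ A := (Finset.mem_erase.1 hcE).2
  have hdA : d ∈ A := (Finset.mem_erase.1 hdE).2
  have hab : a ≠ b := by rintro rfl; simp at haB
  have hac : a ≠ c := by rintro rfl; simp at haB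
  have had : a ≠ d := by rintro rfl; simp at haB
  -- one-layer in the five-name form
  have hiso' : ∀ u, u ≠ o → u ≠ a → u ≠ b → u ≠ c → u ≠ d → w s(o, u) = 0 := fun u h0 h1 h2 h3 h4 =>
    hiso u fun huA => by rcases hmemA u huA with h | h | h | h | h <;> contradiction
  -- the regime in the four-term form
  have hself : (prodBernoulli w).real (openConn o o) = 1 := by
    have : (openConn o o : Set (BondConfig (Fin n))) = Set.univ :=
      Set.eq_univ_of_forall fun ω => (SimpleGraph.Reachable.refl o : (openGraph ω).Reachable o o)
    rw [this, probReal_univ]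
  have hsum : ∑ x ∈ A, (prodBernoulli w).real (openConn o x) =
      1 + ((prodBernoulli w).real (openConn o a) + (prodBernoulli w).real (openConn o b) +
        (prodBernoulli w).real (openConn o c) + (prodBernoulli w).real (openConn o d)) := by
    rw [← Finset.add_sum_erase A _ ho, hself, ← hAB]
    have hb' : b ∉ ({c, d} : Finset (Fin n)) := by simp [hbc, hbd]
    have hc' : c ∉ ({d} : Finset (Fin n)) := by simp [hcd]
    rw [Finset.sum_insert haB, Finset.sum_insert hb', Finset.sum_insert hc', Finset.sum_singleton]
    ring
  have hreg : 3 < (prodBernoulli w).real (openConn o a) + (prodBernoulli w).real (openConn o b) +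
      (prodBernoulli w).real (openConn o c) + (prodBernoulli w).real (openConn o d) := by
    rw [hsum] at hEN; linarith
  -- THEOREM OL
  obtain ⟨x, hx, hle⟩ :=
    oneLayer_twoFingerHub_glued_of_regime w o a b c d hao hbo hco hdo hab hac had hbc hbd hcd hiso' hreg
  have hxA : x ∈ A := by rcases hx with rfl | rfl | rfl | rfl <;> assumption
  have hxo : x ≠ o := by rcases hx with rfl | rfl | rfl | rfl <;> assumption
  -- `{|T_o| ≤ 2}` misses the two-of-four event
  set T : Set (BondConfig (Fin n)) := {ω : BondConfig (Fin n) |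
      (ω ∈ openConn o a ∧ ω ∈ openConn o b) ∨ (ω ∈ openConn o a ∧ ω ∈ openConn o c) ∨
      (ω ∈ openConn o a ∧ ω ∈ openConn o d) ∨ (ω ∈ openConn o b ∧ ω ∈ openConn o c) ∨
      (ω ∈ openConn o b ∧ ω ∈ openConn o d) ∨ (ω ∈ openConn o c ∧ ω ∈ openConn o d)} with hT
  have hincl : {ω : BondConfig (Fin n) | (A.filter fun x => ω ∈ openConn o x).card ≤ 2} ⊆ Tᶜ := by
    intro ω hω
    have hω' : (A.filter fun x => ω ∈ openConn o x).card ≤ 2 := hω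
    have key : ∀ y z, y ∈ A → z ∈ A → y ≠ o → z ≠ o → y ≠ z →
        ω ∈ openConn o y → ω ∈ openConn o z → False := by
      intro y z hyA hzA hyo hzo hyz hy hz
      have h3 : 2 < (A.filter fun x => ω ∈ openConn o x).card := by
        rw [Finset.two_lt_card_iff]
        refine ⟨o, y, z, ?_, Finset.mem_filter.2 ⟨hyA, hy⟩, Finset.mem_filter.2 ⟨hzA, hz⟩,
          hyo.symm, hzo.symm, hyz⟩
        exact Finset.mem_filter.2 ⟨ho, (SimpleGraph.Reachable.refl o : (openGraph ω).Reachable o o)⟩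
      omega
    simp only [Set.mem_compl_iff, hT, Set.mem_setOf_eq]
    rintro (⟨h1, h2⟩ | ⟨h1, h2⟩ | ⟨h1, h2⟩ | ⟨h1, h2⟩ | ⟨h1, h2⟩ | ⟨h1, h2⟩)
    · exact key a b haA hbA hao hbo hab h1 h2
    · exact key a c haA hcA hao hco hac h1 h2
    · exact key a d haA hdA hao hdo had h1 h2
    · exact key b c hbA hcA hbo hco hbc h1 h2
    · exact key b d hbA hdA hbo hdo hbd h1 h2
    · exact key c d hcA hdA hco hdo hcd h1 h2
  calc (prodBernoulli w).real {ω : BondConfig (Fin n) | (A.filter fun x => ω ∈ openConn o x).card ≤ 2}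
      ≤ (prodBernoulli w).real Tᶜ := measureReal_mono hincl (measure_ne_top _ _)
    _ = 1 - (prodBernoulli w).real T := probReal_compl_eq_one_sub MeasurableSet.of_discrete
    _ ≤ 1 - (prodBernoulli w).real (openConn o x) := by linarith
    _ = (prodBernoulli w).real (openConn o x)ᶜ := (probReal_compl_eq_one_sub MeasurableSet.of_discrete).symm
    _ ≤ t := hcut x hxA hxo

/-- **`oneCut(5)` at a one-layer observer-relay** (instance of `OneCut5`, every `n`): five relays `A ∋ o` with every pair
`{o,u}`, `u ∉ A`, of weight `0`; then `μ{1 ≤ N ∧ N < E N/2} ≤ t` for every `t ≥ 0` bounding the relay–relay cuts.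
Case `E N ≤ 4` is the lonely-relay lemma (`oneCut_of_sum_le_four`); case `E N > 4` is
`twoFingerHub_at_oneLayer_observer` via `minority_subset_le_two`. [cite: KozmaNitzan2024, Lemma 2 (p. 6), Lemma 5 (p. 13)] -/
theorem oneCut5_at_oneLayer_observer (w : Sym2 (Fin n) → unitInterval) (A : Finset (Fin n)) (o : Fin n) (t : ℝ)
    (hA : A.card = 5) (ho : o ∈ A) (hiso : ∀ u, u ∉ A → w s(o, u) = 0) (ht : 0 ≤ t)
    (hcut : ∀ a ∈ A, ∀ a' ∈ A, a ≠ a' → (prodBernoulli w).real (openConn a a')ᶜ ≤ t) :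
    (prodBernoulli w).real {ω : BondConfig (Fin n) |
        1 ≤ (A.filter fun a => ω ∈ openConn o a).card ∧
        ((A.filter fun a => ω ∈ openConn o a).card : ℝ) <
          (∑ a ∈ A, (prodBernoulli w).real (openConn o a)) / 2} ≤ t := by
  by_cases hEN : (∑ x ∈ A, (prodBernoulli w).real (openConn o x)) ≤ 4
  · exact oneCut_of_sum_le_four n w A o t hEN ht hcut
  · have hEN' : 4 < ∑ x ∈ A, (prodBernoulli w).real (openConn o x) := lt_of_not_ge hEN
    have hsub : {ω : BondConfig (Fin n) | 1 ≤ (A.filter fun a => ω ∈ openConn o a).card ∧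
        ((A.filter fun a => ω ∈ openConn o a).card : ℝ) < (∑ a ∈ A, (prodBernoulli w).real (openConn o a)) / 2} ⊆
        {ω : BondConfig (Fin n) | (A.filter fun x => ω ∈ openConn o x).card ≤ 2} :=
      fun ω hω => (minority_subset_le_two w A o hA hω).2
    exact (measureReal_mono hsub).trans
      (twoFingerHub_at_oneLayer_observer w A o hA ho hiso hEN' t fun b hb hbo => hcut o ho b hb (Ne.symm hbo))

end OneCutFive

end Summit.CriticalPhenomena.PercolationContinuityZ3.Theorems

end
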